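/-
Origin: expansion seat `planner-pub-hodgecm-pv02-g7-0`, handover THREE: `import Pv02g7.WeilThetaModelDeriv` -> `import HodgeCM.Automorphic.WeilThetaModelDeriv`; `import Pv02g7.WeilThetaModelHeisenbergLinear` -> `import HodgeCM.Automorphic.WeilThetaModelHeisenbergLinear`; `import Pv14g6.SchrodingerInfinitesimal` -> `import HodgeCM.Automorphic.SchrodingerInfinitesimal` (pv14-g6 #12 2800b937); other import HodgeCM.Automorphic.KernelModelHeisenberg (tree r29) uncha (`HOME/pub-hodgecm-pv02-g7/lean/Pv02g7/KernelModelHeisenbergDeriv.lean`, md5 ee3b0ae4, 106 lines);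
landed by the gen-8 packager in gate run 30 as `HodgeCM/Automorphic/KernelModelHeisenbergDeriv.lean` (import ^import Pv02g7\.WeilThetaModelHeisenbergLinear[ \t]*$→import HodgeCM.Automorphic.WeilThetaModelHeisenbergLinear ×1; import ^import Pv02g7\.WeilThetaModelDeriv[ \t]*$→import HodgeCM.Automorphic.WeilThetaModelDeriv ×1; import ^import Pv14g6\.SchrodingerInfinitesimal[ \t]*$→import HodgeCM.Automorphic.SchrodingerInfinitesimal ×1).
-/
/-
Copyright (c) 2026. All rights reserved.
Released under Apache 2.0 license as described in the file LICENSE.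
Origin: pub-hodgecm-pv02-g7 (DAG-node prover #02, gen 7), file #6; target
`HodgeCM/Automorphic/KernelModelHeisenbergDeriv.lean`.  NEW ADDITIVE LEAF; imports this seat's #3 and #4 and
pv14-g6's #12 under their WIP names (`Pv02g7.…` / `Pv14g6.…` ↦ `HodgeCM.Automorphic.…` at landing), the tree
module `HodgeCM.Automorphic.KernelModelHeisenberg` (pv15-g5, gate run 29) and Mathlib only.
-/
import Summits.HodgeConjecture.HodgeCM.Automorphic.WeilThetaModelDeriv
import Summits.HodgeConjecture.HodgeCM.Automorphic.WeilThetaModelHeisenbergLinear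
import Summits.HodgeConjecture.HodgeCM.Automorphic.SchrodingerInfinitesimal
import Summits.HodgeConjecture.HodgeCM.Automorphic.KernelModelHeisenberg_3

/-!
# Differentiable vectors of the centre–Heisenberg kernel model along every Heisenberg direction

pv15-g5's kernel model `HeisenbergKernel.centerModel V L m Γz hΓz : WeilThetaModel Circle Γz (Heis V) (arith V L m)`
has the HEISENBERG GROUP in the `G`-slot: its Weil action `ω` IS the weight-`m` Schrödinger representation
`ρ_m` on `𝓢(V, ℂ)` (`centerModel_omg`).  Consequently the model-level analytic predicate of file #4
(`WeilThetaModel.HasSKDerivAt`, = the `smooth` / `hF` input shape of the PerL end-state records after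
`hasSKDerivAt_zero_iff_tendsto_coe_smul` / pv11-g9's `smooth_clause_of_hasSKDerivAt`) can be VERIFIED on this
constructed model along EVERY one-parameter subgroup `γ_{a,b,c}(s) = (s a, s b, 𝐞(s c − s²⟪a,b⟫/2))` of the
Heisenberg group, with the genuinely non-scalar generator
`dρ_m(a, b, c) = −∂_a + 2πi m ⟪b, ·⟫ + 2πi m c`, IN THE SCHWARTZ TOPOLOGY: this is pv14-g6's infinitesimal
Schrödinger representation `tendsto_repCLM_expCurve_sub_div` transported through the (inducing) inclusion
`𝒮^κ ⊆ S(X)` and the `ℝ`- versus `ℂ`-difference-quotient bookkeeping of file #4.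

* `linearStr_centerModel`: the kernel model is a LINEAR Weil theta model (fields = those of
  `linearStr_heisenbergModel`, file #3: same datum `datumH`, `SK = univ`);
* `centerModel_omg_mk`: `ω(h)⟨Φ, _⟩ = ⟨ρ_m(h)Φ, _⟩`;
* `hasSKDerivAt_centerModel_expCurve`: **`HasSKDerivAt (fun s => ω(γ_{a,b,c}(s)) Φ) (dρ_m(a,b,c) Φ) 0`** for
  every `a b : V`, `c : ℝ`, `Φ ∈ 𝒮^κ = 𝓢(V, ℂ)`;
* `tendsto_centerModel_expCurve_sub_smul`: the same in the `((s:ℝ):ℂ)⁻¹ • (ω(γ(s))Φ − Φ) ⟶ dρ_m(a,b,c)Φ` shape of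
  the end-state `smooth` fields.

Scope, honestly: first derivative at the identity along one-parameter subgroups of `Heis V` (the group this
model puts in the `G`-slot); nothing about `U(W_b)`-directions of PerL (no constructed model has `G = U(W_b)`),
nothing adelic, no higher derivatives.  No hypothesis beyond the model's own parameters; nothing cited.
-/

noncomputable section

open scoped Real FourierTransform SchwartzMap RealInnerProductSpace Topology LineDeriv
open Complex Filter

namespace HodgeCM
namespace SchwartzWeil
namespace HeisenbergKernel

variable (V : Type) [NormedAddCommGroup V] [InnerProductSpace ℝ V] [FiniteDimensional ℝ V] [MeasurableSpace V]
  [BorelSpace V] (L : Submodule ℤ V) [DiscreteTopology L] (m : ℤ) (Γz : Subgroup Circle)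
  (hΓz : ∀ z ∈ Γz, z ^ m = 1)

/-- **The centre–Heisenberg kernel model is a LINEAR Weil theta model** (`S(X) = 𝓢(V, ℂ)` with its vector-space
structure, `ρ_m(h)` linear, `Θ` linear in `Φ`, `𝒮^κ = univ`). -/
instance linearStr_centerModel : (centerModel V L m Γz hΓz).LinearStr where
  instACG := inferInstanceAs (AddCommGroup 𝓢(V, ℂ))
  instMod := inferInstanceAs (Module ℂ 𝓢(V, ℂ))
  act_add := fun S Φ Ψ => (repCLM V m S).map_add Φ Ψ
  act_smul := fun S a Φ => (repCLM V m S).map_smul a Φ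
  theta_add := fun Φ Ψ S => thetaH_add V L m Φ Ψ S
  theta_smul := fun a Φ S => thetaH_smul V L m a Φ S
  zero_mem := Set.mem_univ _
  add_mem := fun _ _ => Set.mem_univ _
  smul_mem := fun _ _ _ => Set.mem_univ _

/-- `ω(h)⟨Φ, _⟩ = ⟨ρ_m(h) Φ, _⟩` in `𝒮^κ = univ`. -/
theorem centerModel_omg_mk (h : Heis V) (Φ : 𝓢(V, ℂ)) :
    (centerModel V L m Γz hΓz).omg h ⟨Φ, Set.mem_univ Φ⟩ = ⟨repCLM V m h Φ, Set.mem_univ _⟩ :=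
  Subtype.ext (centerModel_omg V L m Γz hΓz h ⟨Φ, Set.mem_univ Φ⟩)

omit [FiniteDimensional ℝ V] [MeasurableSpace V] [BorelSpace V] in
/-- The `ℝ`- and the `ℂ`-scaled difference quotients agree on `𝓢(V, ℂ)`. -/
theorem coe_inv_smul_schwartz (s : ℝ) (Ψ : 𝓢(V, ℂ)) : ((s : ℝ) : ℂ)⁻¹ • Ψ = s⁻¹ • Ψ := by
  ext v
  rw [smul_apply, smul_apply, smul_eq_mul, Complex.real_smul, Complex.ofReal_inv]

/-- **Every Schwartz vector is a differentiable vector of the kernel model along every Heisenberg direction, in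
the Schwartz topology**: `HasSKDerivAt (s ↦ ω(γ_{a,b,c}(s)) Φ) (dρ_m(a,b,c) Φ) 0` with
`dρ_m(a,b,c) Φ = −∂_a Φ + (2πi m⟪b,·⟫) Φ + (2πi m c) Φ` (pv14-g6 `tendsto_repCLM_expCurve_sub_div`, transported). -/
theorem hasSKDerivAt_centerModel_expCurve (a b : V) (c : ℝ) (Φ : 𝓢(V, ℂ)) :
    (centerModel V L m Γz hΓz).HasSKDerivAt
      (fun s => (centerModel V L m Γz hΓz).omg (Heis.expCurve a b c s) ⟨Φ, Set.mem_univ Φ⟩)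
      ⟨-∂_{a} Φ + SchwartzMap.smulLeftCLM ℂ (fun x : V => 2 * π * I * ((⟪(m : ℝ) • b, x⟫ : ℝ) : ℂ)) Φ
          + (2 * π * I * ((m : ℝ) * c)) • Φ, Set.mem_univ _⟩ 0 := by
  rw [WeilThetaModel.hasSKDerivAt_zero_iff_tendsto_coe_smul, Topology.IsInducing.subtypeVal.tendsto_nhds_iff]
  refine (tendsto_repCLM_expCurve_sub_div V m a b c Φ).congr fun s => ?_
  rw [Function.comp_apply, WeilThetaModel.coe_smul, WeilThetaModel.coe_sub, centerModel_omg_mk,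
    centerModel_omg_mk, repCLM_expCurve_zero]
  exact (coe_inv_smul_schwartz V s _).symm

/-- The same in the shape of the end-state `smooth` fields:
`((s:ℝ):ℂ)⁻¹ • (ω(γ_{a,b,c}(s)) Φ − Φ) ⟶ dρ_m(a,b,c) Φ` in `𝒮^κ` along `𝓝[≠] 0`. -/
theorem tendsto_centerModel_expCurve_sub_smul (a b : V) (c : ℝ) (Φ : 𝓢(V, ℂ)) :
    Tendsto (fun s : ℝ => ((s : ℝ) : ℂ)⁻¹ •
        ((centerModel V L m Γz hΓz).omg (Heis.expCurve a b c s) ⟨Φ, Set.mem_univ Φ⟩ - ⟨Φ, Set.mem_univ Φ⟩))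
      (𝓝[≠] 0)
      (𝓝 (⟨-∂_{a} Φ + SchwartzMap.smulLeftCLM ℂ (fun x : V => 2 * π * I * ((⟪(m : ℝ) • b, x⟫ : ℝ) : ℂ)) Φ
          + (2 * π * I * ((m : ℝ) * c)) • Φ, Set.mem_univ _⟩ : (centerModel V L m Γz hΓz).SK)) := by
  have h := WeilThetaModel.hasSKDerivAt_zero_iff_tendsto_coe_smul.mp
    (hasSKDerivAt_centerModel_expCurve V L m Γz hΓz a b c Φ)
  simpa only [centerModel_omg_mk, repCLM_expCurve_zero] using h

end HeisenbergKernel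
end SchwartzWeil
end HodgeCM
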